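import Summits.Parity.BatemanHorn.Theses.AlmostPrimeZeros
import Summits.Parity.BatemanHorn.Statement
import HarnessLib.Audit.CruxProbe

/-!
# Redirect-strategist r1 probes (BC2 / BC7 style) for crux `SystemLSDRealSegment` (stmt-Parity-11292) and the three
# family-class pieces of the prepared split D0 (`Cruxes/SystemLSDRealSegment/SPLIT-PREPARED.md`, bodies verbatim from
# `SplitSketch.lean`).  S = `_root_.BatemanHorn` (the sub-problem Statement), X = the crux.
# Expected: every `implies-summit` (C → S, Xᵢ → S, Xᵢ → X) FAILS; `summit-implies` X → Xᵢ fires (restriction, informational).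
-/

namespace Summit.Parity.BatemanHorn.Cruxes.SystemLSDRealSegment.StrategistR1

open scoped BigOperators Topology Classical
open Filter Set Function

/-- piece `LinearPairSegmentLaw` of split D0 (verbatim from SplitSketch.lean). -/
def LinearPairSegmentLaw : Prop :=
  ∀ f : Fin 2 → Polynomial ℤ, Literature.NumberTheory.Sieve.IsBatemanHornSystem f → (f 0).natDegree = 1 → (f 1).natDegree = 1 → ∃ Λ : ℂ → ℂ, DifferentiableOn ℂ Λ (Metric.ball 0 2) ∧ Λ 0 = (Literature.NumberTheory.Sieve.batemanHornConst f : ℂ) ∧ ∀ y : ℝ, 5 / 4 < y → y < 7 / 4 → Filter.Tendsto (fun x : ℕ => (x : ℂ)⁻¹ * Complex.exp (((2 : ℕ) : ℂ) * (1 - (y : ℂ)) * (Real.log (Real.log x) : ℂ)) * ∑ n ∈ Finset.range (x + 1), (y : ℂ) ^ (∑ i, (((f i).eval (n : ℤ)).toNat.factorization.sum fun _ v => min v 2))) Filter.atTop (nhds (Λ y * Complex.exp (((y : ℂ) - 1) * (Real.log (∏ i, ((f i).natDegree : ℝ)) : ℂ)) * (Complex.Gamma y)⁻¹ ^ (2 :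 ℕ)))

/-- piece `QuadraticSegmentLaw` of split D0 (verbatim from SplitSketch.lean). -/
def QuadraticSegmentLaw : Prop :=
  ∀ f : Fin 1 → Polynomial ℤ, Literature.NumberTheory.Sieve.IsBatemanHornSystem f → (f 0).natDegree = 2 → ∃ Λ : ℂ → ℂ, DifferentiableOn ℂ Λ (Metric.ball 0 2) ∧ Λ 0 = (Literature.NumberTheory.Sieve.batemanHornConst f : ℂ) ∧ ∀ y : ℝ, 5 / 4 < y → y < 7 / 4 → Filter.Tendsto (fun x : ℕ => (x : ℂ)⁻¹ * Complex.exp (((1 : ℕ) : ℂ) * (1 - (y : ℂ)) * (Real.log (Real.log x) : ℂ)) * ∑ n ∈ Finset.range (x + 1), (y : ℂ) ^ (∑ i, (((f i).eval (n : ℤ)).toNat.factorization.sum fun _ v => min v 2))) Filter.atTop (nhds (Λ y * Complex.exp (((y : ℂ) - 1) * (Real.log (∏ i, ((f i).natDegree : ℝ)) : ℂ)) * (Complex.Gamma y)⁻¹ ^ (1 : ℕ)))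

/-- piece `HighDegreeSegmentLaw` of split D0 (verbatim from SplitSketch.lean). -/
def HighDegreeSegmentLaw : Prop :=
  ∀ (k : ℕ) (f : Fin k → Polynomial ℤ), Literature.NumberTheory.Sieve.IsBatemanHornSystem f → 3 ≤ ∑ i, (f i).natDegree → ∃ Λ : ℂ → ℂ, DifferentiableOn ℂ Λ (Metric.ball 0 2) ∧ Λ 0 = (Literature.NumberTheory.Sieve.batemanHornConst f : ℂ) ∧ ∀ y : ℝ, 5 / 4 < y → y < 7 / 4 → Filter.Tendsto (fun x : ℕ => (x : ℂ)⁻¹ * Complex.exp ((k : ℂ) * (1 - (y : ℂ)) * (Real.log (Real.log x) : ℂ)) * ∑ n ∈ Finset.range (x + 1), (y : ℂ) ^ (∑ i, (((f i).eval (n : ℤ)).toNat.factorization.sum fun _ v => min v 2))) Filter.atTop (nhds (Λ y * Complex.exp (((y : ℂ) - 1) * (Real.log (∏ i, ((f i).natDegree : ℝ)) : ℂ)) * (Complex.Gamma y)⁻¹ ^ k))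


set_option h21.cruxProbe.batteryMs 90000

/-! ## The crux against the route (P1–P5; P5 = C → S / S → C with S = _root_.BatemanHorn via `closes`) -/
#h21_crux_probe Summit.Parity.BatemanHorn.Theses.AlmostPrimeZeros.SystemLSDRealSegment route := "route-Parity-AlmostPrimeZeros"

/-! ## The three pieces against the summit S -/
#h21_crux_probe Summit.Parity.BatemanHorn.Cruxes.SystemLSDRealSegment.StrategistR1.LinearPairSegmentLaw summit := _root_.BatemanHorn
#h21_crux_probe Summit.Parity.BatemanHorn.Cruxes.SystemLSDRealSegment.StrategistR1.QuadraticSegmentLaw summit := _root_.BatemanHorn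
#h21_crux_probe Summit.Parity.BatemanHorn.Cruxes.SystemLSDRealSegment.StrategistR1.HighDegreeSegmentLaw summit := _root_.BatemanHorn

/-! ## The three pieces against the crux X (Xᵢ → X must fail; X → Xᵢ is the restriction, informational) -/
#h21_crux_probe Summit.Parity.BatemanHorn.Cruxes.SystemLSDRealSegment.StrategistR1.LinearPairSegmentLaw summit := Summit.Parity.BatemanHorn.Theses.AlmostPrimeZeros.SystemLSDRealSegment
#h21_crux_probe Summit.Parity.BatemanHorn.Cruxes.SystemLSDRealSegment.StrategistR1.QuadraticSegmentLaw summit := Summit.Parity.BatemanHorn.Theses.AlmostPrimeZeros.SystemLSDRealSegment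
#h21_crux_probe Summit.Parity.BatemanHorn.Cruxes.SystemLSDRealSegment.StrategistR1.HighDegreeSegmentLaw summit := Summit.Parity.BatemanHorn.Theses.AlmostPrimeZeros.SystemLSDRealSegment

end Summit.Parity.BatemanHorn.Cruxes.SystemLSDRealSegment.StrategistR1
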